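import Summits.BirchSwinnertonDyer.BirchSwinnertonDyer.Theorems.CongruentShaFreeCutLinkBStructure
import Summits.BirchSwinnertonDyer.BirchSwinnertonDyer.Theorems.CongruentShaFreeCutTwoAdicControlOfPoitouTate
import Summits.BirchSwinnertonDyer.BirchSwinnertonDyer.Theorems.MordellShaFreeCutOfHeegnerNonTorsion

/-! # Route `MordellShaFreeCut` (rung S2b) — crux `AnalyticRankOneOfRankOneFiniteShaThree`
(stmt-BirchSwinnertonDyer-19160): the structure of Link B `ThreeAdicCharValueEqHeegnerLogSq` — its
EQUIVALENCE with crux B on the crux's own data (the S2b twin of `CongruentShaFreeCutLinkBStructure`)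

Cell `bsd-cn100`, prover seat `bsd-cn100-s2-c3` g4 (filed as service for the s2b hand). Supports, does
not close, stmt-BirchSwinnertonDyer-19160. HONEST FRAMING: theorems ABOUT the two open links of the
registered skeleton `three-adic-links` (`MordellShaFreeCutThreeAdicLinks`, p424081); every statement is
CONDITIONAL on the hypotheses it names (Link A / Poitou–Tate, Kato, modularity, Gross–Zagier +
Kolyvagin, crux B itself); nothing about BSD, the leaf `rankOne_threeConverse_cubeSum`, Sylvester's
problem or any case of BSD is proved, and no link is proved.

## What is proved

The generic half is `CongruentShaFreeCutLinkBStructure.charValueEqLogSqAt_iff` /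
`…_of_hasCharValuationAt_of_not_isOfFinAddOrder` / `…_iff_not_isOfFinAddOrder` (any curve, any `p`:
`AcPConverseLinks.CharValueEqLogSqAt … P` ⟺ `𝔛` `Λ`-torsion ∧ `char 𝔛 = (F)` ∧ (`F(0) = 0 ↔ P`
torsion); granted Link A's `∃ m, HasCharValuationAt … m` at the datum, ⟺ `P` non-torsion). Here, for
the curves `W/ℚ` with `j = 0` (the Mordell curves `E_D : y² = x³ + D` up to `ℚ`-isomorphism) at `p = 3`:

* `threeAdicCharValue_onCruxData_of_linkA_of_heegnerNonTorsion` — on the data of crux B (`W`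
  elliptic, globally minimal, `j = 0`; `K` with the Heegner hypotheses for `N(W)` and `3`;
  `L(W^{(d_K)}, 1) ≠ 0`; `rank W(ℚ) = 1`; `#Ш(W/ℚ)[3^∞] < ∞`; any `(ι, v, v̄, κ, γ)`; any Heegner
  point `P`), Link A `ThreeAdicControlOfRankOne` + "Heegner points are non-torsion on that data" (the
  conclusion shape of `MordellShaFreeCutOfHeegnerNonTorsion.heegnerNonTorsion_of_crux`) + Kato give
  the conclusion of Link B `ThreeAdicCharValueEqHeegnerLogSq`;
* **`threeAdicCharValue_onCruxData_of_cruxB`** — hence, granted Poitou–Tate (Link A modulo that one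
  fact: `CongruentShaFreeCutTwoAdicControlOfPoitouTate.threeAdicControlOfRankOne_of_poitouTate`,
  p432373), Kato, modularity and Gross–Zagier + Kolyvagin, **crux B `AnalyticRankOneOfRankOneFiniteShaThree`
  implies Link B on crux B's own data**; with `cruxB_of_threeAdicLinks` (p424081) the two are
  EQUIVALENT there modulo these named facts — as for S2, the split isolates no statement strictly
  between Link A and crux B on the rank-one data, and what the registered Link B says beyond crux B
  lives on the corank-one data («`𝔛` `Λ`-torsion ∧ (`F(0) = 0 ↔ P_K` torsion)»);
* `threeAdicCharValue_iff_not_isOfFinAddOrder_onCruxData` — the pointwise equivalence granted Link A.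
[cite: CastellaGrossiLeeSkinner2022, §5.2 (proof of Thm. 5.2.1: shape of a BDP-type p-converse)]
[cite: Castella2018, Thm. 2.3 and Thm. 3.2 (arXiv:1704.06608 pp. 5, 9) (shapes)]
[cite: GrossZagier1986, Thm. I.6.3 with V.§2] -/

set_option linter.dupNamespace false

noncomputable section

open scoped Classical

namespace Summit.BirchSwinnertonDyer.BirchSwinnertonDyer.Theorems.MordellShaFreeCutLinkBStructure

open WeierstrassCurve NumberField IsDedekindDomain Field Literature.NumberTheory.EllipticCurves
  Literature.NumberTheory.EllipticCurves.Castella2018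
open Literature.NumberTheory.GaloisRepresentations Literature.NumberTheory.GaloisCohomology
open Summit.BirchSwinnertonDyer.BirchSwinnertonDyer.Theses.MordellShaFreeCut
  (AnalyticRankOneOfRankOneFiniteShaThree)
open Summit.BirchSwinnertonDyer.BirchSwinnertonDyer.Theorems.MordellShaFreeCutOfHeegnerNonTorsion
  (heegnerNonTorsion_of_crux)
open Summit.BirchSwinnertonDyer.BirchSwinnertonDyer.Theorems.MordellShaFreeCutThreeAdicLinks
  (ThreeAdicControlOfRankOne ThreeAdicCharValueEqHeegnerLogSq)
open Summit.BirchSwinnertonDyer.BirchSwinnertonDyer.Theorems.CongruentShaFreeCutLinkBStructure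
  (charValueEqLogSqAt_of_hasCharValuationAt_of_not_isOfFinAddOrder
    charValueEqLogSqAt_iff_not_isOfFinAddOrder)
open Summit.BirchSwinnertonDyer.BirchSwinnertonDyer.Theorems.CongruentShaFreeCutTwoAdicControlOfPoitouTate
  (threeAdicControlOfRankOne_of_poitouTate)

/-- **On the data of crux B of S2b, Link A + non-torsion of Heegner points there (+ Kato) give Link
B's conclusion.** For `W/ℚ` elliptic, globally minimal with `j = 0`, `K` imaginary quadratic with the
Heegner hypotheses for `N = N(W)` and `3`, `L(W^{(d_K)}, 1) ≠ 0`, `rank W(ℚ) = 1`, `#Ш(W/ℚ)[3^∞] < ∞`,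
any `(ι, v, v̄, κ, γ)` as in the links and any Heegner point `P ∈ W(K)` of level `N`:
`CharValueEqLogSqAt W 3 κ v̄ γ ι P`. Proof: Kato descends the rank-one data to `K`, Link A (`hA`)
gives `F(0) ≠ 0`, `hNT` gives `P` non-torsion, and the generic
`charValueEqLogSqAt_of_hasCharValuationAt_of_not_isOfFinAddOrder` concludes. CONDITIONAL on `hA`,
`hNT`, `hKato`; credits nothing. [cite: CastellaGrossiLeeSkinner2022, §5.2 (proof of Thm. 5.2.1) (shape)]
[cite: Kato2004Asterisque, Cor. 14.3 (p. 235)] -/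
theorem threeAdicCharValue_onCruxData_of_linkA_of_heegnerNonTorsion
    (hKato : ∀ (W : WeierstrassCurve ℚ) [W.IsElliptic] (p : ℕ) [Fact p.Prime],
      kato_finite_of_L_one_ne_zero W p)
    (hA : ThreeAdicControlOfRankOne)
    (hNT : ∀ (W : WeierstrassCurve ℚ) [W.IsElliptic] [W.IsGloballyMinimal], W.j = 0 →
      ∀ (K : Type) [Field K] [NumberField K] (N : ℕ) [NeZero N], W.conductorNorm ℤ = N →
        IsImaginaryQuadratic K → SatisfiesHeegnerHypothesis N K → SatisfiesHeegnerHypothesis 3 K →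
          (W.quadraticTwist (NumberField.discr K : ℚ)).entireLFunction 1 ≠ 0 →
            W.mordellWeilRank = 1 → Finite (AddCommGroup.primaryComponent W.sha 3) →
              ∀ (P : (W.baseChange K).toAffine.Point), IsHeegnerPoint N W K P →
                ¬ IsOfFinAddOrder P)
    (W : WeierstrassCurve ℚ) [W.IsElliptic] [W.IsGloballyMinimal] (hj : W.j = 0)
    (K : Type) [Field K] [NumberField K] (N : ℕ) [NeZero N]
    (hN : W.conductorNorm ℤ = N) (hK : IsImaginaryQuadratic K)
    (hHN : SatisfiesHeegnerHypothesis N K) (hH3 : SatisfiesHeegnerHypothesis 3 K)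
    (hL : (W.quadraticTwist (NumberField.discr K : ℚ)).entireLFunction 1 ≠ 0)
    (hrank : W.mordellWeilRank = 1) (hsha : Finite (AddCommGroup.primaryComponent W.sha 3))
    (ι : K →+* ℚ_[3]) (v vbar : HeightOneSpectrum (𝓞 K))
    (hv : ∀ x : 𝓞 K, x ∈ v.asIdeal ↔ ‖ι (x : K)‖ < 1) (hvbar : ((3 : ℕ) : 𝓞 K) ∈ vbar.asIdeal)
    (hne : vbar ≠ v) (κ : ZpExtension K 3) (hκ : κ.IsAnticyclotomic)
    (γ : absoluteGaloisGroup K) [Fact (κ.IsTopGenerator γ)]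
    (P : (W.baseChange K).toAffine.Point) (hP : IsHeegnerPoint N W K P) :
    AcPConverseLinks.CharValueEqLogSqAt W 3 κ vbar γ ι P := by
  obtain ⟨hrk, -, hshaK⟩ := AcPConverseLinks.rank_corank_sha_baseChange_of_twist_L_one_ne_zero
    hKato W 3 hK hL hrank hsha
  exact charValueEqLogSqAt_of_hasCharValuationAt_of_not_isOfFinAddOrder ι
    (hA W hj K N hN hK hHN hH3 ι v vbar hv hvbar hne κ hκ γ hrk hshaK)
    (hNT W hj K N hN hK hHN hH3 hL hrank hsha P hP)

/-- **Crux B of S2b implies its Link B on crux B's own data** (granted Poitou–Tate, Kato, modularity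
and Gross–Zagier + Kolyvagin): `threeAdicCharValue_onCruxData_of_linkA_of_heegnerNonTorsion` with
Link A from Poitou–Tate (`threeAdicControlOfRankOne_of_poitouTate`, p432373) and non-torsion of the
Heegner points from crux B (`heegnerNonTorsion_of_crux`: modularity for the Artin formalism,
Gross–Zagier + Kolyvagin). Together with `cruxB_of_threeAdicLinks` (Link A → Link B → crux B), Link
B restricted to crux B's data and crux B are EQUIVALENT modulo these named facts. CONDITIONAL;
credits nothing. [cite: GrossZagier1986, Thm. I.6.3 with V.§2]
[cite: MilneADT2006, Ch. I, Thm. 4.10(b) (hypothesis kept)] -/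
theorem threeAdicCharValue_onCruxData_of_cruxB
    (hmod : ModularForms.exists_isNewformOf)
    (hGZ : ∀ (W : WeierstrassCurve ℚ) (N : ℕ) [NeZero N] (K : Type) [Field K] [NumberField K],
      analyticRankEK_eq_one_iff_heegner_nonTorsion W N K)
    (hKato : ∀ (W : WeierstrassCurve ℚ) [W.IsElliptic] (p : ℕ) [Fact p.Prime],
      kato_finite_of_L_one_ne_zero W p)
    (hPT : ∀ (K : Type) [Field K] [NumberField K], poitouTate_sum_localTatePairing_eq_zero K)
    (hB : AnalyticRankOneOfRankOneFiniteShaThree)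
    (W : WeierstrassCurve ℚ) [W.IsElliptic] [W.IsGloballyMinimal] (hj : W.j = 0)
    (K : Type) [Field K] [NumberField K] (N : ℕ) [NeZero N]
    (hN : W.conductorNorm ℤ = N) (hK : IsImaginaryQuadratic K)
    (hHN : SatisfiesHeegnerHypothesis N K) (hH3 : SatisfiesHeegnerHypothesis 3 K)
    (hL : (W.quadraticTwist (NumberField.discr K : ℚ)).entireLFunction 1 ≠ 0)
    (hrank : W.mordellWeilRank = 1) (hsha : Finite (AddCommGroup.primaryComponent W.sha 3))
    (ι : K →+* ℚ_[3]) (v vbar : HeightOneSpectrum (𝓞 K))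
    (hv : ∀ x : 𝓞 K, x ∈ v.asIdeal ↔ ‖ι (x : K)‖ < 1) (hvbar : ((3 : ℕ) : 𝓞 K) ∈ vbar.asIdeal)
    (hne : vbar ≠ v) (κ : ZpExtension K 3) (hκ : κ.IsAnticyclotomic)
    (γ : absoluteGaloisGroup K) [Fact (κ.IsTopGenerator γ)]
    (P : (W.baseChange K).toAffine.Point) (hP : IsHeegnerPoint N W K P) :
    AcPConverseLinks.CharValueEqLogSqAt W 3 κ vbar γ ι P :=
  threeAdicCharValue_onCruxData_of_linkA_of_heegnerNonTorsion hKato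
    (threeAdicControlOfRankOne_of_poitouTate hPT) (heegnerNonTorsion_of_crux hmod hGZ hB)
    W hj K N hN hK hHN hH3 hL hrank hsha ι v vbar hv hvbar hne κ hκ γ P hP

/-- **On crux B's data (S2b), granted Link A there, Link B's conclusion at a Heegner point is
EQUIVALENT to that point being non-torsion.** CONDITIONAL on `hA` and Kato; credits nothing.
[cite: CastellaGrossiLeeSkinner2022, §5.2 (proof of Thm. 5.2.1) (shape)] -/
theorem threeAdicCharValue_iff_not_isOfFinAddOrder_onCruxData
    (hKato : ∀ (W : WeierstrassCurve ℚ) [W.IsElliptic] (p : ℕ) [Fact p.Prime],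
      kato_finite_of_L_one_ne_zero W p)
    (hA : ThreeAdicControlOfRankOne)
    (W : WeierstrassCurve ℚ) [W.IsElliptic] [W.IsGloballyMinimal] (hj : W.j = 0)
    (K : Type) [Field K] [NumberField K] (N : ℕ) [NeZero N]
    (hN : W.conductorNorm ℤ = N) (hK : IsImaginaryQuadratic K)
    (hHN : SatisfiesHeegnerHypothesis N K) (hH3 : SatisfiesHeegnerHypothesis 3 K)
    (hL : (W.quadraticTwist (NumberField.discr K : ℚ)).entireLFunction 1 ≠ 0)
    (hrank : W.mordellWeilRank = 1) (hsha : Finite (AddCommGroup.primaryComponent W.sha 3))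
    (ι : K →+* ℚ_[3]) (v vbar : HeightOneSpectrum (𝓞 K))
    (hv : ∀ x : 𝓞 K, x ∈ v.asIdeal ↔ ‖ι (x : K)‖ < 1) (hvbar : ((3 : ℕ) : 𝓞 K) ∈ vbar.asIdeal)
    (hne : vbar ≠ v) (κ : ZpExtension K 3) (hκ : κ.IsAnticyclotomic)
    (γ : absoluteGaloisGroup K) [Fact (κ.IsTopGenerator γ)]
    (P : (W.baseChange K).toAffine.Point) :
    AcPConverseLinks.CharValueEqLogSqAt W 3 κ vbar γ ι P ↔ ¬ IsOfFinAddOrder P := by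
  obtain ⟨hrk, -, hshaK⟩ := AcPConverseLinks.rank_corank_sha_baseChange_of_twist_L_one_ne_zero
    hKato W 3 hK hL hrank hsha
  exact charValueEqLogSqAt_iff_not_isOfFinAddOrder ι
    (hA W hj K N hN hK hHN hH3 ι v vbar hv hvbar hne κ hκ γ hrk hshaK)

end Summit.BirchSwinnertonDyer.BirchSwinnertonDyer.Theorems.MordellShaFreeCutLinkBStructure

end
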